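import Mathlib
import HarnessLib
import HarnessLib.Audit
import Summits.HubbardSuperconductivity.Statement
import Literature.MathematicalPhysics.QuantumLattice.FermionOperatorsProofs
import Literature.MathematicalPhysics.QuantumLattice.LatticeToriProofs
import Literature.MathematicalPhysics.QuantumLattice.LatticeToriLROProofs
import Literature.MathematicalPhysics.QuantumLattice.PairCorrelationsProofs
import Literature.MathematicalPhysics.QuantumLattice.FockRelabel
import Summits.HubbardSuperconductivity.HubbardSuperconductivity.Theorems.LiebTwinUniformLROGivesSummitMatrix

/-!
Route: RelocationFloor

DORMANT since 2026-09-03T13:03:28Z (reconciler: no traction for 5 d (last activity item-proof-filed at 2026-08-29T12:05:08Z); parked, not closed — `ledger route dormant route-HubbardSuperconductivity-RelocationFloor --off` to reactivate) — unstaffed, not closed; items shared with open routes are served there. `ledger route dormant <id> --off` reactivates.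

# Route RelocationFloor — relocation floor — every-GS d-wave order read off one eigenvector as
(bounded pair-relocation work of |ψ|) × (B1g sign coherence of far pair transplants)

It suffices to show X := B1gSignCoherence ∧ BoundedPairRelocationWork ∧ PairSiteDensity (realises
the fermionic line (B) of idea card
hellinger-port-sign-factorisation, critic-graded new-mechanism 2026-08-15, unrouted). Fix the box B
= [2,5]×[1/5,3/10] ∋ (U,δ). For a normalised
(N_L,S^z=0)-sector ground state ψ of hubbardTorus 2 L 1 U and two far DIRECTED bonds b=(x,e),
b'=(y,e') (e,e' unit steps) let A_b = c_{x↑}c_{x+e,↓}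
and φ := A_b† A_{b'} ψ (the PAIR TRANSPLANT of ψ from b' to b; in the occupation basis |φ(τ)| =
|ψ(T⁻¹τ)| is ψ RELOCATED, p := ‖φ‖² =
⟨n_{y↑}n_{y+e'↓}(1−n_{x↑})(1−n_{x+e↓})⟩_ψ its mass). Since √2·Δ_d = pairField dWaveFormFactor L =
√2·Σ_{z,e} g_d(e) A_{z,e}, the summit's
order functional is 2Σ g_d(e)g_d(e')Re⟨ψ, A_b†A_{b'}ψ⟩, and each far term FACTORS through one
eigenvector: g g'·Re⟨ψ,φ⟩ ≥ 2ε·Σ_τ|ψ(τ)||φ(τ)|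
(K4: B1g SIGN COHERENCE, ε>0 at ONE point of B, translation-averaged per displacement) · Σ_τ|ψ||φ| ≥
e^{−K}·p/2 (K3: at least half the transplant
mass keeps the modulus ratio |ψ|/|φ| ≥ e^{−K} — BOUNDED MEDIAN RELOCATION WORK of |ψ|², for all of
B) · p ≥ p₀ (P3: pair site density, all of B).
Hence a·L⁴ ≤ Re⟨ψ,Δ_d†Δ_dψ⟩ for every ground state eventually, a = εe^{−K}p₀ (the floor, support
RelocationFloorToUniformLRO — PROVED INSIDE `closes` since rev 2), and the summit at (U,δ) by the
even-side liminf bookkeeping (support UniformLROGivesSummitMatrix — ALSO PROVED INSIDE `closes`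
since rev 2, from
Literature `sum_torusPullback_succ`, `sum_pairFieldCorr_succ`, `pairFieldCorr_succ_le`). No
energies, no source field, no trial state, no family of Hamiltonians.
Lean: `B1gSignCoherence ∧ BoundedPairRelocationWork ∧ PairSiteDensity`

## Assembly
CRUX-ONLY deciding theorem (rev 2, route-repair 2026-08-16; lean rc 0, 0 sorries, axioms
propext/Classical.choice/Quot.sound,
native #h21_check_closes ok, non_crux = []): `closes (h4 : B1gSignCoherence) (h3 :
BoundedPairRelocationWork)
(hp : PairSiteDensity) : HubbardSuperconductivity`. The two SUPPORT items are discharged INSIDE the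
proof under their names:
`UniformLROGivesSummitMatrix` := even-side liminf bookkeeping inline (at side M = m+1:
`sum_torusPullback_succ` +
`sum_pairFieldCorr_succ` turn the LRO term into Re⟨ψ_M,Δᴴ Δψ_M⟩/M⁴, floor below,
`pairFieldCorr_succ_le` cap above; then
`le_liminf_of_le` along k ↦ 2k — Literature imports only, no Theses/Theorems dependency);
`RelocationFloorToUniformLRO` := the floor —
(E1) `pairField_dWaveFormFactor_eq` + CAR (`annihilation_anticommute_holds`,
`TorusSite.sum_sub_shift`) give
pairField g_d L = √2·Σ_x Σ_{e∈unitSteps} g_d(e)·A x e, A x e = c_{x↑}c_{x+e,↓}; (E2) bilinear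
expansion (`expect_sum`, `expect_smul`)
and re-indexing y = x+r (`Fintype.sum_equiv (Equiv.addLeft x)`) give Re⟨ψ,Δᴴ Δψ⟩ = 2 Σ_r Σ_{e,e'} g
g' Σ_x Re⟨ψ,(A x e)ᴴ A (x+r) e' ψ⟩;
(far r, torusDist r 0 ≥ R) K4, then K3 ∧ P3 at the bond pair (x,x+r): Σ_τ|ψ||φ_x| ≥
e^{−K}Σ_good|φ_x|² ≥ e^{−K}‖φ_x‖²/2 ≥ e^{−K}p₀/2,
so the (r,e,e') term is ≥ εe^{−K}p₀L²; (every r) each overlap Re⟨c c ψ, c c ψ⟩ ≤ 1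
(`PosSemidefTrace.expect_conjTranspose_mul`,
Cauchy–Schwarz, `norm_toLp_annihilation_mulVec_le`) and |g_d| ≤ 1, so ≥ −16L²; (count) ≤ (2R+1)²
displacements are nearer than R
(`card_filter_torusDist_le`, `torusDist_comm'`); hence Re⟨ψ,Δᴴ Δψ⟩ ≥ c₀L⁴ for L ≥ L₀, c₀ =
εe^{−K}p₀, at K4's witness point
(U,δ) ∈ [2,5]×[1/5,3/10] ⊂ (0,∞)×(0,1/2); close with ⟨U, _, δ, _, bookkeeping U δ ⟨c₀, _, L₀,
floor⟩⟩.
The `Assembly` item (B1g → K3 → P3 → Floor → Bookkeeping → summit) stays as filed (provable by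
`closes`).

Rationale: WHY THIS LINE. Every open route certifies order through SPECTRAL or FAMILY data (penalised energies,
flux responses, sourced order, anchors continued along a
path, RG flows, certificates over operators) — exactly what the Goldstone tower
(Literature.Barriers.HubbardSuperconductivity.LROForcesLowLyingStates)
makes expensive; this line reads the summit's functional off ONE eigenvector by the
Feynman–Penrose–Onsager overlap picture turned into an
inequality (Feynman1953, doi:10.1103/physrev.104.576, Yang1962): Jensen/quantile floor Σ|ψ||φ| ≥
e^{−K}p/2 on the positive measure |ψ|²
(imported: relative-entropy / Hellinger-affinity floors of the BEC summit's cards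
hellinger-affinity-of-environments, palm-hellinger-debye-landscape,
credited) and the EXACT sign/modulus split g g'Re⟨ψ,A_b†A_b'ψ⟩ = (1−2η̃)·Σ|ψ||φ| (η̃ = |ψφ|-weighted
B1g phase infidelity), which isolates the
sign problem of S as one bounded statistic per distance (Wu–Weng–Zaanen sign structure
arXiv:0802.2455, TroyerWiese2005 for why nothing samples it).
Why X is easier than S although stronger: K3 and P3 concern |ψ| only — the Perron vector of the
signed-basis fixed-node Hamiltonian FN(H,ψ)
(GubernatisKawashimaWerner2016 §11.2), so positivity technology (Harnack chains, CLT/locality of one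
measure's two-site relocation cost, the
BEC-summit landscape estimates) applies — while K4 is a statement about WHICH configuration-space
paths are frustration-free (the satisfied
network of D_|ψ|(H−E₀)D_|ψ| ⪰ 0 is connected and the transplant sign is the ℤ₂ flux of any
frustration-free path, card §P2), a combinatorial object
no other route exposes. Nearest routes and the delta: FixedNodeShadow (energies of node-constrained
shadows + node release along a Hamiltonian path),
SignStructure (¬S by witness CLASSES), IsoperimetricCascade (floor from the overlap with the flat
AGP trial state) — here the true ground state's
overlap with ITS OWN two-site relocation, per state, whatever the degeneracy.

RANKED CRUXES. #2 B1gSignCoherence (crux; DERIVED since 2026-08-17 — BC2 redirect: ⇐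
DWaveChannelSelection ∧ TransplantNondegeneracy ∧ BlochPairSiteDensity by the PROVED glue
B1gSignCoherenceOfSubs, Cruxes/B1gSignCoherence/B1gSignCoherenceSplit.lean; the formal `route edit
--split` is queued for the strategist's final cycle / tenure planner, children.json on the item) —
card K4, translation-averaged: at SOME (U,δ) ∈ [2,5]×[1/5,3/10] there are ε>0, R, L₀ such that for
every even L ≥ L₀, every normalised (N_L,0)-sector ground state ψ, every displacement r with
torusDist r 0 ≥ R and all unit steps e,e': 2ε·Σ_x Σ_τ |ψ(τ)|·|φ_x(τ)| ≤ g_d(e)g_d(e')·Σ_x Re⟨ψ,φ_x⟩,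
φ_x := A_{(x,e)}†A_{(x+r,e')}ψ — the weighted B1g phase infidelity of far pair transplants stays ≤
1/2 − ε (the sign content of S as one number per distance). [difficulty: open-problem] (why it might
fail: it IS the sign problem of the doped repulsive model in one statistic: phase strings
(Wu–Weng–Zaanen) can drive η̃→1/2 with the modulus overlap intact (Cooper-pair Bose metal), a PDW
makes g g'Re⟨⟩ oscillate in r; 4×4 ED (card j004204/j004378) shows η̃≈0.2–0.56 in d-wave classes up
to U=6.) [arXiv:0802.2455, Weng2011, TroyerWiese2005, Yang1962, QinEtAl2020, DengEtAl2015]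
#2 TransplantNondegeneracy (crux; piece X₂ of K4, stmt-HubbardSuperconductivity-18070) — COHERENT
FRACTION (magnitude, no sign or channel): at SOME (U,δ) ∈ B there are ε>0, R, L₀ such that for every
even L ≥ L₀, every normalised BLOCH (N_L,0)-sector ground state ψ (eigenvector of every lattice
translation fockTranslate v), every r with torusDist r 0 ≥ R and unit steps e,e': 2ε·Σ_x
‖A_{(x,e)}†A_{(x+r,e')}ψ‖² ≤ |Σ_x Re⟨ψ, A_{(x,e)}†A_{(x+r,e')}ψ⟩| — a fixed fraction of the
transplant mass survives coherently in the far pair correlation; a PDW or s± condensate would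
satisfy it. [difficulty: open-problem] (why it might fail: it is the condensation content: at U=0
Wick gives |S| ≈ L²G(r)² ~ L²r⁻³ ≪ Q ≈ pL²; in B the coherent fraction ε ~ |F|²/p may be
e^{−c/U²}-small yet must be uniform in L, r — phase-string disordering / Cooper-pair Bose metal or
edge stripes drive |S|/Q → 0.) [Yang1962, doi:10.1103/physrev.104.576, arXiv:0802.2455, Weng2011,
QinEtAl2020, ArovasBergKivelsonRaghu2022]
#3 DWaveChannelSelection (crux; piece X₁ of K4, stmt-HubbardSuperconductivity-17960) — CHANNEL
SELECTION (sign only, no magnitude): for every (U,δ) ∈ B and every ε>0 there are R, L₀ such that for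
every even L ≥ L₀, every normalised Bloch sector ground state ψ, every far r and unit steps e,e': IF
2ε·Σ_x ‖A_{(x,e)}†A_{(x+r,e')}ψ‖² ≤ |Σ_x Re⟨ψ, A_{(x,e)}†A_{(x+r,e')}ψ⟩| THEN 0 ≤ g_d(e)g_d(e')·Σ_x
Re⟨ψ, A_{(x,e)}†A_{(x+r,e')}ψ⟩ — any far pair condensate visible in B sits in the B1g channel;
vacuous where correlations decay (U=0). [difficulty: XL] (why it might fail: the condensate in B
need not be pure d_{x²−y²}: an extended-s/s± admixture, a pair-density wave or a finite-momentum
condensate near the box edge makes some far (r,e,e') with |S| ≥ 2εQ carry the wrong sign;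
Kohn–Luttinger selects B1g only as U→0.) [RaghuKivelsonScalapino2010, DengEtAl2015, Scalapino1995,
QinEtAl2020, XuEtAl2024]
#3 BoundedPairRelocationWork (crux) — card K3 (median form), on the whole box: for every (U,δ) ∈
[2,5]×[1/5,3/10] there are K, R, L₀ such that for every even L ≥ L₀, every normalised sector ground
state ψ, all sites x,y with torusDist x y ≥ R and unit steps e,e', with φ := A_{(x,e)}†A_{(y,e')}ψ:
‖φ‖² ≤ 2·Σ_{τ : e^{−K}|φ(τ)| ≤ |ψ(τ)|} |φ(τ)|² — at least half of the transplant mass keeps the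
modulus ratio |ψ|/|φ| ≥ e^{−K} (median relocation work of |ψ|² bounded uniformly in L and distance).
[difficulty: XL] (why it might fail: no tool bounds a conditional MEDIAN of log|ψ_GS| for fermions
uniformly in L (Harnack along a relocation path loses a factor per hop; near-nodal amplitudes); in
1-D (Tonks/Luttinger) the work grows like log d, and a stripe/phase-separated ground state in the
box makes it linear in d.) [Feynman1953, doi:10.1103/physrev.104.576, Reatto1969,
GubernatisKawashimaWerner2016, QinEtAl2020]
#4 PairSiteDensity (crux) — card P3, on the whole box: for every (U,δ) ∈ [2,5]×[1/5,3/10] there are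
p₀>0, R, L₀ such that for every even L ≥ L₀, every normalised sector ground state ψ, all x,y with
torusDist x y ≥ R and unit steps e,e': p₀ ≤ ‖A_{(x,e)}†A_{(y,e')}ψ‖² =
⟨n_{y↑}n_{y+e'↓}(1−n_{x↑})(1−n_{x+e↓})⟩_ψ — the transplant mass (a four-point DENSITY correlation)
is bounded below: no macroscopic segregation of ↑↓ neighbour pairs in any ground state. [difficulty:
L] (why it might fail: 'every ground state' at 'every far pair': phase separation or a commensurate
charge/stripe order inside the box empties specific sublattices of ↑↓ neighbour pairs along some
even L (PureModelStripeCompetition sits at (8,1/8), outside B, but the box edge U=5, δ=1/5 is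
untested).) [QinEtAl2020, XuEtAl2024, ArovasBergKivelsonRaghu2022, Sorella2023]
#5 BlochPairSiteDensity (crux; piece X₃ of K4, stmt-HubbardSuperconductivity-18071) — for every
(U,δ) ∈ B there are p₀>0, R, L₀ such that for every even L ≥ L₀, every normalised Bloch sector
ground state ψ, every far r and unit steps e,e': p₀·L² ≤ Σ_x ‖A_{(x,e)}†A_{(x+r,e')}ψ‖² — the
x-summed, Bloch-only form of PairSiteDensity (#4 implies it); it normalises the modulus overlap of
K4 by Cauchy–Schwarz. [difficulty: L] (why it might fail: only if some Bloch ground state in B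
macroscopically anti-correlates ↑↓ neighbour pairs with neighbour hole pairs at a far displacement —
phase separation / commensurate charge order at the box edge U=5, δ=1/5.) [QinEtAl2020, XuEtAl2024,
ArovasBergKivelsonRaghu2022, Sorella2023]
#9 RelocationFloorToUniformLRO (support) — the floor (provable now): K4 at its point (U,δ) ∈ B, K3
and P3 there, give for each far displacement r and unit steps e,e': Σ_x g
g'Re⟨ψ,A_{(x,e)}†A_{(x+r,e')}ψ⟩ ≥ 2εΣ_x Σ_τ|ψ||φ_x| ≥ 2ε e^{−K} Σ_x Σ_{good τ}|φ_x|² ≥ ε e^{−K} p₀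
L²; with pairField dWaveFormFactor L = √2 Σ_{z,e} g_d(e) A_{(z,e)} (CAR reindexing of localPair:
c_{x↓}c_{x+e↑} = −A_{(x+e,−e)}, g_d even) the order functional is 2Σ_{r,e,e'}Σ_x g g'Re⟨…⟩ ≥
32εe^{−K}p₀L²(L² − (2R+1)²) − 32(2R+1)²L² ≥ 16εe^{−K}p₀·L⁴ eventually; 0<2≤U and [1/5,3/10] ⊂
(0,1/2) give the conclusion's side conditions. [difficulty: provable-now] [Scalapino1995, Yang1962,
Feynman1953]
#9 UniformLROGivesSummitMatrix (support) — SHARED item stmt-HubbardSuperconductivity-10968 (route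
IntrinsicLargeN; PROVED: Theorems/IntrinsicLargeNGlue uniformLROGivesSummitMatrix_proof; identical
signature re-filed so the gate attaches this route): an eventual uniform every-ground-state floor
a·L⁴ ≤ Re⟨ψ,Δ_d†Δ_dψ⟩ at (U,δ) gives the summit's matrix at (U,δ) (even-side liminf bookkeeping).
[difficulty: provable-now] [Scalapino1995, Yang1962]
#9 B1gSignCoherenceOfSubs (support, stmt-HubbardSuperconductivity-18072) — the glue
DWaveChannelSelection → TransplantNondegeneracy → BlochPairSiteDensity → B1gSignCoherence, PROVED
(theorem B1gSignCoherence_of_subs + by-name wrapper b1gSignCoherenceOfSubs in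
Cruxes/B1gSignCoherence/B1gSignCoherenceSplit.lean, farm rc0, 0 sorries, standard axioms): at the
point of X₂, X₁∧X₂ give 2εQ ≤ g g'S on Bloch ground states; both sides are expectations of
translation-invariant operators (H_q = Σ_x T_x†T_x, H_s = Σ_x T_x), so the Hermitian form X = g
g'(H_s + H_s†) − 4εH_q is ≥ 0 on Bloch ground states and, by the VARIATIONAL BLOCH REDUCTION (the
minimiser of Re⟨ψ,Xψ⟩ over the unit sphere of the translation-invariant sector ground eigenspace is
a joint eigenvector of the unit translations — exists_unit_common_eigenvector_isMinOn of
FunctionFieldCertificateMesoscopicPairOrderBlochAbstract), on EVERY ground state; the same reduction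
turns X₃ into p₀L² ≤ Q_ψ; Cauchy–Schwarz twice gives Σ_xΣ_τ|ψ||φ_x| ≤ L·Q^{1/2} ≤ Q/√p₀, hence K4
with ε' = ε√p₀. Theorems landing is prover-only: land the workfile verbatim as
Theorems/RelocationFloorB1gSignCoherenceSplit.lean --workitem stmt-HubbardSuperconductivity-18072.
[difficulty: provable-now] [Tasaki2020, Scalapino1995, Yang1962]

TWO-LAYER PLAN. FILED 2026-08-17 (strategist): B1gSignCoherence ⇐ DWaveChannelSelection ∧
TransplantNondegeneracy ∧ BlochPairSiteDensity, glue proved (see #9 B1gSignCoherenceOfSubs and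
Cruxes/B1gSignCoherence/SPLIT.md; the originally foreseen flux reading is DEAD as stated: rigid
no-exchange pair transport closes loops of trivial fermionic sign, i.e. it yields the A1g character,
and an exact B1g gauge on configurations is refuted by a one-↑-two-↓ exchange loop). Originally
foreseen glued splits (kept for the record): B1gSignCoherence ⇐ SatisfiedNetworkConnectivity
(Loewner L_Frus ⪯ L_Sat ⇒ the satisfied
hop network is connected on supp ψ; provable now, card P2) → RigidSatTransport (weight-most far
transplants admit a frustration-free path moving the
↑↓ pair rigidly, encircling no electron, so the transplant sign is the B1g rotation character) →
B1gSignCoherence. BoundedPairRelocationWork ⇐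
ShadowRelocationCLT (for the fixed-node shadow FN(H,ψ) the relocation cost F = h_x − h_y is a
difference of two LOCAL insertion costs with bounded
variance in d = 2) → MedianFromVariance (Chebyshev) → BoundedPairRelocationWork. PairSiteDensity ⇐
NoMacroscopicSegregation (four-point density
correlations of every ground state bounded below at far separation in B) → PairSiteDensity.
Calibration targets that stay OUT of the item list (no
hypothesis of `closes` follows from them): the card's bosonic K1/K2 (bounded swap work of the XXZ
pair gas; near-ferromagnet spin-wave law) — they
belong to routes PlaquetteBoson/AnisotropyChord as engines for PbHalfFilledXYOrder, or to
Literature.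

KILL CRITERIA. B1gSignCoherence refuted substantively at every point of B (e.g. a certified η̃ → 1/2
along r for ground states on L ≥ 12 tori/cylinders at the
box's best point, or a theorem that translation-averaged far transplant signs of every sector ground
state decorrelate at all (U,δ) ∈ B) ⇒ the line
is dead in this box: close `refuted:B1gSignCoherence` unless the refutation is regional (then
restate on the surviving sub-box once, never twice).
BoundedPairRelocationWork refuted (median work ≥ c·log d or linear in d for some ground state in B)
⇒ the modulus half fails where fermions are
concerned: pivot to the card's bosonic line (A) only if PlaquetteBoson's PbHalfFilledXYOrder is
still open, else close. PairSiteDensity refuted ⇒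
misstated almost surely (segregation at a box edge): shrink B by a restate.
UniformLROGivesSummitMatrix is proved; RelocationFloorToUniformLRO refuted
⇒ a typing slip (restate). S proved by any weak-coupling route at some (U,δ) moots the route but not
its cruxes (they remain the only per-eigenvector
reading of S).

NOT DECOMPOSED YET. (K4 IS decomposed since 2026-08-17, see TWO-LAYER PLAN; what follows concerns
the pieces.) Inside TransplantNondegeneracy: the ODLRO-scale floor c·L² ≤ |S| for Bloch ground
states (birth stub) and its mechanism; inside DWaveChannelSelection: the parallel (g g' = +1,
non-negative) vs perpendicular (g g' = −1, non-positive) character classes (birth stubs). The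
frustration-free-path / ℤ₂-flux reading of the transplant sign (card P2: SatConnectivity,
FluxReading) and the identity g g'Re⟨ψ,φ⟩ = (1−2η̃)Σ|ψ||φ|
(real ψ) are deliberately NOT items: the cruxes are stated as inequalities so that complex members
of a degenerate ground eigenspace are covered and no
definition request is needed; η̃, the swap work W and the satisfied network enter at the first
split. The choice of the witness point inside B, the
constants (ε, K, p₀ — expected ε ~ e^{−c/U²}-small at the weak edge, K = O(1), p₀ ≈ (n/2)²(1−n/2)² ≈
0.05), and any use of the purification
Ψ = e^{−βH/2} (T>0 form) are layer 2.

CHEAPEST FALSIFIER. Already RUN by the card's author (kit jobs j004203, j004254, j004266, j004204,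
j004378; evidence evidence-swap-work.md on the card): the floor is never
violated (0/300+ rows); 2-D bosonic relocation-work increments per log d are 6–7× below 1-D at equal
size; the fermionic control passes (U = −6 on-site
transplants: η̃ ≤ 0.04 at all distances by Lieb's spin-reflection positivity) while the 4×4
repulsive d-wave classes show η̃ ≈ 0.2–0.56 with the modulus
overlap Σ|ψ||φ|/p ≈ 0.45 constant in distance and U — consistent with K3, inconclusive for K4 (4×4
cannot pair). The next cheapest check, for a
refuter: η̃(r) and the median work from DMRG/VMC amplitudes of a width-6 cylinder ground state at
(U,δ) = (4,1/4): η̃ → 1/2 with distance kills K4 at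
that point; median work growing like log d kills K3.

NUMBERS. Box B = [2,5]×[1/5,3/10] (away from the catalogued stripe window [6,8]×[1/10,1/6] of
PureModelStripeCompetition; d_{x²−y²} is the Kohn–Luttinger
channel for 0.6 < n < 1 at t'=0, RaghuKivelsonScalapino2010 p.7, DengEtAl2015 Fig. 1). Card ED
(hard-core bosons, 6×4, V=0): W(d) = 0.12…0.29 for
d = (1,0)…(3,2); V=1.98: W = 0.87, 1.68, 1.90, 1.99; 4×4 Hubbard (5,5)-sector δ=0.375: Σ|ψ||φ|/p ≈
0.45 (U=0…6), η̃(d-wave classes) = .18–.56;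
U=−6 on-site control η̃ = .007–.038. Floor constant a = 16·ε·e^{−K}·p₀. Items at open: 6 (3 cruxes,
2 supports, the assembly; no target).

DEFINITION REQUESTS. None. A_b, φ, the modulus overlap and the transplant mass are written inline
over annihilation / orb / FermionTorus.ofTorusSite / Torus.proj /
unitSteps / torusDist / dWaveFormFactor (all `lean search`ed; Sketch.lean rc 0). Optional later
(layer 2): `swapWork`, `signInfidelity` as
Summits/HubbardSuperconductivity/HubbardSuperconductivity/Theorems notions if provers want named
objects.

Novelty: Searches (2026-08-16): all 55 Theses headers of the sub + `ledger idea list --status all` (165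
cards) read; `ledger negatives --problem HubbardSuperconductivity` (2);
`lit frontier HubbardSuperconductivity --since 2023` (30 rows: arXiv:2603.13212 Yin–Lucas robust
DISCRETE SSB in gapless magnets — not U(1); arXiv:2601.18868
numerical Penrose–Onsager diagnostics; arXiv:2410.00810 bootstrap = AbsenceCertificate class); `lit
read arxiv:2603.13212 --pages 1-3`; the card's own
recorded searches (hybrid/vector ×2, zbMATH ×3, arXiv ×4, crossref ×8, galaxy --star all ×2 and
--mode intelligent: no swap/KL/Hellinger order floor for
lattice fermions) and the mechanism critic's reduction attempt (VMC estimator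
Gros1989/ParamekantiRanderiaTrivedi2004/ZhangGrosRiceShiba1988 computes,
does not bound; phase-string reading Weng2011 is the sign half only). Candidate levers examined and
reduced this cycle (NOTES.md): Ginibre/Griffiths
continuation (closed card ginibre-upset-phase-engine), Tasaki-1993 RVB anchors (closed card),
Feshbach–Schur (closed card), quadratic-source gapping
(goldstone-stable-continuation), diamagnetic/Thomson stiffness floors (wrong direction), Yin–Lucas
(discrete only).
Nearest prior art found: in-hub card hellinger-port-sign-factorisation (realised here, credited; its
engine = AtomisticToContinuum/BoseEinsteinCondensation cards
hellinger-affinity-of-environments, palm-hellinger-debye-landscape); printed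
doi:10.1103/physrev.104.576 (Penrose–Onsager), Feynman1953, Reatto1  [refs: 10.1103/physrev.104.576, 2603.13212, 2601.18868, 2410.00810, 0802.2455, arxiv:2603.13212, doi:10.1103/physrev.104.576, Gros1989, ParamekantiRanderiaTrivedi2004, ZhangGrosRiceShiba1988, Weng2011, Feynman1953, Reatto1969, Yang1962]

Barriers (technique_class: relative-entropy-floor, sign-amplitude-factorisation): - technique_class: relative-entropy-floor, sign-amplitude-factorisation
- Literature.Barriers.HubbardSuperconductivity.LROForcesLowLyingStates: evaded — no spectral datum
(gap, tower, clustering, uniqueness) enters; the floor is per eigenvector, so 'every ground state'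
is handled state by state whatever the degeneracy (K4 is translation-averaged precisely so that
momentum-mixed members of a degenerate eigenspace are covered).
- Literature.Barriers.HubbardSuperconductivity.SignProblemNPHard: it does not evade it and says so —
B1gSignCoherence IS the sign content of S, isolated as one statistic; nothing is sampled, no generic
solver is claimed (the barrier's reach is programmable couplings, SignProblemNPHardNarrow).
- Literature.Barriers.HubbardSuperconductivity.GeneralizedHartreeFockNoPairing: not in class — no
quasi-free variational state; Slater determinants are exactly where K3∧K4 fail (card control),
consistent with BLS.
- Literature.Barriers.HubbardSuperconductivity.PositiveTemperatureNoPairLRO /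
HohenbergMerminWagnerPairing: not met (T = 0 eigenvectors only; the purified T>0 form would have
divergent work in d = 2, consistent with Koma–Tasaki).
- Literature.Barriers.HubbardSuperconductivity.WeakCouplingCeiling / StrongCouplingCeiling /
PerturbativeInvisibilityOfPairing: no expansion in U or t/U is used; the box sits at intermediate
coupling by choice, and ε may be exponentially small at its weak edge without harm.
- Literature.Barriers.HubbardSuperconductivity.PureModelS

History (route lifecycle, newest last):
- 2026-08-23T11:48:33Z · DORMANT — reconciler: no traction for 6.1 d (last activity item-proof-filed at 2026-08-17T09:28:58Z); parked, not closed — `ledger route dormant route-HubbardSuperconduct (operator:999:946381)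
- 2026-08-29T10:32:36Z · REACTIVATED — reconciler: reactivated — activity item-proof-filed at 2026-08-29T09:31:24Z after parking at 2026-08-23T11:48:33Z (operator:999:2604581)
- 2026-09-03T13:03:28Z · DORMANT — reconciler: no traction for 5 d (last activity item-proof-filed at 2026-08-29T12:05:08Z); parked, not closed — `ledger route dormant route-HubbardSuperconductiv (operator:999:2828229)

sub-problem: HubbardSuperconductivity · status: dormant · opened planner-plan-novel-HubbardSuperconductivity-Hub-0943e37c-g2-0 2026-08-16T14:37:14Z · rev 7 · ledger route-HubbardSuperconductivity-RelocationFloor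
GENERATED by the gate from the ledger (D-0016/17). Provers cite these decls: `theorem foo : Summit.HubbardSuperconductivity.HubbardSuperconductivity.Theses.RelocationFloor.<Decl> := …` in Summits/HubbardSuperconductivity/HubbardSuperconductivity/Theorems/<Name>.lean.
-/

namespace Summit.HubbardSuperconductivity.HubbardSuperconductivity.Theses.RelocationFloor

open scoped BigOperators Topology Manifold Classical MeasureTheory ProbabilityTheory Matrix InnerProductSpace ComplexConjugate ContinuousMap
open Filter Set Function TopologicalSpace MeasureTheory

attribute [summit_statement] _root_.HubbardSuperconductivity

open Literature.Hubbard

/-- item stmt-HubbardSuperconductivity-15377 · crux · rank 2 · open · by planner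
why it might fail: it IS the sign problem of the doped repulsive model in one statistic: phase strings (Wu–Weng–Zaanen) can drive η̃→1/2 with the modulus overlap intact (Cooper-pair Bose metal), a PDW makes g g'Re⟨⟩ oscillate in r; 4×4 ED (card j004204/j004378) shows η̃≈0.2–0.56 in d-wave classes up to U=6.
sources: arXiv:0802.2455, Weng2011, TroyerWiese2005, Yang1962, QinEtAl2020, DengEtAl2015
[crux] card K4, translation-averaged: at SOME (U,δ) ∈ [2,5]×[1/5,3/10] there are ε>0, R, L₀ such
that for every even L ≥ L₀, every normalised (N_L,0)-sector ground state ψ, every displacement r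
with torusDist r 0 ≥ R and all unit steps e,e': 2ε·Σ_x Σ_τ |ψ(τ)|·|φ_x(τ)| ≤ g_d(e)g_d(e')·Σ_x
Re⟨ψ,φ_x⟩, φ_x := A_{(x,e)}†A_{(x+r,e')}ψ — the weighted B1g phase infidelity of far pair
transplants stays ≤ 1/2 − ε (the sign content of S as one number per distance). [difficulty:
open-problem] -/
@[route_item "route-HubbardSuperconductivity-RelocationFloor"]
def B1gSignCoherence : Prop :=
  open Literature.MathematicalPhysics.QuantumLattice Literature.Probability.LatticeModels in ∃ U ∈ Set.Icc (2 : ℝ) 5, ∃ δ ∈ Set.Icc (1 / 5 : ℝ) (3 / 10), ∃ ε : ℝ, 0 < ε ∧ ∃ R L₀ : ℕ, ∀ (L : ℕ) [NeZero L], L₀ ≤ L → Even L → ∀ ψ : Fock (Orb (FermionTorus 2 L)), star ψ ⬝ᵥ ψ = 1 → IsGroundStateInSector (hubbardTorus 2 L 1 U) (2 * ⌊(1 - δ) * (L : ℝ) ^ 2 / 2⌋₊) 0 ψ → ∀ r : TorusSite 2 L, R ≤ torusDist r 0 → ∀ e ∈ unitSteps, ∀ e' ∈ unitSteps, let A : TorusSite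 2 L → Site 2 → Matrix (Finset (Orb (FermionTorus 2 L))) (Finset (Orb (FermionTorus 2 L))) ℂ := fun x u => annihilation (orb (FermionTorus.ofTorusSite x) 0) * annihilation (orb (FermionTorus.ofTorusSite (x + Torus.proj L u)) 1); let φ : TorusSite 2 L → Fock (Orb (FermionTorus 2 L)) := fun x => ((A x e)ᴴ * A (x + r) e') *ᵥ ψ; 2 * ε * (∑ x : TorusSite 2 L, ∑ τ : Finset (Orb (FermionTorus 2 L)), ‖ψ τ‖ * ‖φ x τ‖) ≤ dWaveFormFactor e * dWaveFormFactor e' * (∑ x : TorusSite 2 L, (star ψ ⬝ᵥ φ x).re)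

/-- item stmt-HubbardSuperconductivity-18070 · crux · rank 2 · open · by planner
why it might fail: it is the condensation content: at U=0 Wick gives |S| ≈ L²G(r)² ~ L²r⁻³ ≪ Q ≈ pL² (refuter note on K4); in B the coherent fraction ε ~ |F|²/p may be e^{−c/U²}-small yet must be uniform in L, r — phase-string disordering / Cooper-pair Bose metal (Weng) or edge stripes (U=5, δ=1/5) drive |S|/Q → 0.
sources: Yang1962, doi:10.1103/physrev.104.576, arXiv:0802.2455, Weng2011, QinEtAl2020, ArovasBergKivelsonRaghu2022
[crux] TRANSPLANT NON-DEGENERACY (coherent fraction; magnitude without sign or channel): at SOME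
(U,δ) ∈ [2,5]×[1/5,3/10] there are ε>0, R, L₀ such that for every even L ≥ L₀, every normalised
Bloch (N_L,0)-sector ground state ψ (eigenvector of every fockTranslate v), every r with torusDist r
0 ≥ R and unit steps e,e': 2ε·Σ_x ‖A_{x,e}ᴴA_{x+r,e'}ψ‖² ≤ |Σ_x Re⟨ψ, A_{x,e}ᴴA_{x+r,e'}ψ⟩| — a
fixed fraction ε of the transplant mass (four-point density ⟨n n (1−n)(1−n)⟩) survives COHERENTLY in
the far translation-summed pair correlation; the sign pattern in (r,e,e'), the point-group channel
and the momentum of the condensate are left open (a PDW or s± state satisfies it). The condensation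
half of B1gSignCoherence. [difficulty: open-problem] -/
@[route_item "route-HubbardSuperconductivity-RelocationFloor"]
def TransplantNondegeneracy : Prop :=
  open Literature.MathematicalPhysics.QuantumLattice Literature.Probability.LatticeModels in ∃ U ∈ Set.Icc (2 : ℝ) 5, ∃ δ ∈ Set.Icc (1 / 5 : ℝ) (3 / 10), ∃ ε : ℝ, 0 < ε ∧ ∃ R L₀ : ℕ, ∀ (L : ℕ) [NeZero L], L₀ ≤ L → Even L → ∀ ψ : Fock (Orb (FermionTorus 2 L)), star ψ ⬝ᵥ ψ = 1 → IsGroundStateInSector (hubbardTorus 2 L 1 U) (2 * ⌊(1 - δ) * (L : ℝ) ^ 2 / 2⌋₊) 0 ψ → (∀ v : TorusSite 2 L, ∃ c : ℂ, (fockTranslate v).val *ᵥ ψ = c • ψ) → ∀ r : TorusSite 2 L, R ≤ torusDist r 0 → ∀ e ∈ unitSteps, ∀ e' ∈ unitSteps, let A : TorusSite 2 L → Site 2 → Matrix (Finset (Orb (FermionTorus 2 L))) (Finset (Orb (FermionTorus 2 L))) ℂ := fun x u => annihilation (orb (FermionTorus.ofTorusSite x) 0) * annihilation (orb (FermionTorus.ofTorusSite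 (x + Torus.proj L u)) 1); let φ : TorusSite 2 L → Fock (Orb (FermionTorus 2 L)) := fun x => ((A x e)ᴴ * A (x + r) e') *ᵥ ψ; 2 * ε * (∑ x : TorusSite 2 L, (star (φ x) ⬝ᵥ φ x).re) ≤ |∑ x : TorusSite 2 L, (star ψ ⬝ᵥ φ x).re|

/-- item stmt-HubbardSuperconductivity-15378 · crux · rank 3 · open · by planner
why it might fail: no tool bounds a conditional MEDIAN of log|ψ_GS| for fermions uniformly in L (Harnack along a relocation path loses a factor per hop; near-nodal amplitudes); in 1-D (Tonks/Luttinger) the work grows like log d, and a stripe/phase-separated ground state in the box makes it linear in d.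
sources: Feynman1953, doi:10.1103/physrev.104.576, Reatto1969, GubernatisKawashimaWerner2016, QinEtAl2020
[crux] card K3 (median form), on the whole box: for every (U,δ) ∈ [2,5]×[1/5,3/10] there are K, R,
L₀ such that for every even L ≥ L₀, every normalised sector ground state ψ, all sites x,y with
torusDist x y ≥ R and unit steps e,e', with φ := A_{(x,e)}†A_{(y,e')}ψ: ‖φ‖² ≤ 2·Σ_{τ : e^{−K}|φ(τ)|
≤ |ψ(τ)|} |φ(τ)|² — at least half of the transplant mass keeps the modulus ratio |ψ|/|φ| ≥ e^{−K}
(median relocation work of |ψ|² bounded uniformly in L and distance). [difficulty: XL] -/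
@[route_item "route-HubbardSuperconductivity-RelocationFloor"]
def BoundedPairRelocationWork : Prop :=
  open Literature.MathematicalPhysics.QuantumLattice Literature.Probability.LatticeModels in ∀ U ∈ Set.Icc (2 : ℝ) 5, ∀ δ ∈ Set.Icc (1 / 5 : ℝ) (3 / 10), ∃ K : ℝ, ∃ R L₀ : ℕ, ∀ (L : ℕ) [NeZero L], L₀ ≤ L → Even L → ∀ ψ : Fock (Orb (FermionTorus 2 L)), star ψ ⬝ᵥ ψ = 1 → IsGroundStateInSector (hubbardTorus 2 L 1 U) (2 * ⌊(1 - δ) * (L : ℝ) ^ 2 / 2⌋₊) 0 ψ → ∀ x y : TorusSite 2 L, R ≤ torusDist x y → ∀ e ∈ unitSteps, ∀ e' ∈ unitSteps, let A : TorusSite 2 L → Site 2 → Matrix (Finset (Orb (FermionTorus 2 L))) (Finset (Orb (FermionTorus 2 L))) ℂ := fun z u => annihilation (orb (FermionTorus.ofTorusSite z) 0) * annihilation (orb (FermionTorus.ofTorusSite (z + Torus.proj L u)) 1); let φ : Fock (Orb (FermionTorus 2 L)) := ((A x e)ᴴ * A y e') *ᵥ ψ; (star φ ⬝ᵥ φ).re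 ≤ 2 * ∑ τ ∈ Finset.univ.filter (fun τ : Finset (Orb (FermionTorus 2 L)) => Real.exp (-K) * ‖φ τ‖ ≤ ‖ψ τ‖), ‖φ τ‖ ^ 2

/-- item stmt-HubbardSuperconductivity-17960 · crux · rank 3 · open · by planner
why it might fail: the condensate in B need not be pure d_{x²−y²}: an extended-s/s± admixture, a pair-density wave (sign of S oscillating in r) or a finite-momentum condensate near the box edge makes some far (r,e,e') with |S| ≥ 2εQ carry the wrong sign; Kohn–Luttinger selects B1g only as U→0, B has U ∈ [2,5].
sources: RaghuKivelsonScalapino2010, DengEtAl2015, Scalapino1995, QinEtAl2020, XuEtAl2024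
[crux] d-WAVE CHANNEL SELECTION (sign only, no magnitude): for every (U,δ) ∈ [2,5]×[1/5,3/10] and
every ε>0 there are R, L₀ such that for every even L ≥ L₀, every normalised (N_L,0)-sector ground
state ψ of hubbardTorus 2 L 1 U that is an eigenvector of EVERY lattice translation fockTranslate v
(a Bloch ground state), every displacement r with torusDist r 0 ≥ R and all unit steps e,e': IF the
translation-summed pair correlation S = Σ_x Re⟨ψ, A_{x,e}ᴴA_{x+r,e'}ψ⟩ (A_{x,u} = c_{x↑}c_{x+u,↓})
is comparable to the transplant mass, 2εQ ≤ |S| with Q = Σ_x ‖A_{x,e}ᴴA_{x+r,e'}ψ‖² (a four-point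
density correlation), THEN it carries the B1g sign 0 ≤ g_d(e)g_d(e')·S. The symmetry-channel half of
B1gSignCoherence: vacuous wherever far pair correlations decay (e.g. U=0, Wick), it only constrains
a condensate that exists. [difficulty: XL] (why it might fail: the condensate in B need not be pure
d_{x²−y²}: an extended-s/s± admixture, a pair-density wave (sign of S oscillating in r) or a
finite-momentum condensate near the box edge makes some far (r,e,e') with |S| ≥ 2εQ carry the wrong
sign; Kohn–Luttinger selects B1g only as U→0, B has U ∈ [2,5].) [RaghuKivelsonScalapino2010,
DengEtAl2015, Scalap -/
@[route_item "route-HubbardSuperconductivity-RelocationFloor"]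
def DWaveChannelSelection : Prop :=
  open Literature.MathematicalPhysics.QuantumLattice Literature.Probability.LatticeModels in ∀ U ∈ Set.Icc (2 : ℝ) 5, ∀ δ ∈ Set.Icc (1 / 5 : ℝ) (3 / 10), ∀ ε : ℝ, 0 < ε → ∃ R L₀ : ℕ, ∀ (L : ℕ) [NeZero L], L₀ ≤ L → Even L → ∀ ψ : Fock (Orb (FermionTorus 2 L)), star ψ ⬝ᵥ ψ = 1 → IsGroundStateInSector (hubbardTorus 2 L 1 U) (2 * ⌊(1 - δ) * (L : ℝ) ^ 2 / 2⌋₊) 0 ψ → (∀ v : TorusSite 2 L, ∃ c : ℂ, (fockTranslate v).val *ᵥ ψ = c • ψ) → ∀ r : TorusSite 2 L, R ≤ torusDist r 0 → ∀ e ∈ unitSteps, ∀ e' ∈ unitSteps, let A : TorusSite 2 L → Site 2 → Matrix (Finset (Orb (FermionTorus 2 L))) (Finset (Orb (FermionTorus 2 L))) ℂ := fun x u => annihilation (orb (FermionTorus.ofTorusSite x) 0) * annihilation (orb (FermionTorus.ofTorusSite (x + Torus.proj L u)) 1); let φ : TorusSite 2 L → Fock (Orb (FermionTorus 2 L)) :=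 fun x => ((A x e)ᴴ * A (x + r) e') *ᵥ ψ; 2 * ε * (∑ x : TorusSite 2 L, (star (φ x) ⬝ᵥ φ x).re) ≤ |∑ x : TorusSite 2 L, (star ψ ⬝ᵥ φ x).re| → 0 ≤ dWaveFormFactor e * dWaveFormFactor e' * (∑ x : TorusSite 2 L, (star ψ ⬝ᵥ φ x).re)

/-- item stmt-HubbardSuperconductivity-15379 · crux · rank 4 · open · by planner
why it might fail: 'every ground state' at 'every far pair': phase separation or a commensurate charge/stripe order inside the box empties specific sublattices of ↑↓ neighbour pairs along some even L (PureModelStripeCompetition sits at (8,1/8), outside B, but the box edge U=5, δ=1/5 is untested).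
sources: QinEtAl2020, XuEtAl2024, ArovasBergKivelsonRaghu2022, Sorella2023
[crux] card P3, on the whole box: for every (U,δ) ∈ [2,5]×[1/5,3/10] there are p₀>0, R, L₀ such that
for every even L ≥ L₀, every normalised sector ground state ψ, all x,y with torusDist x y ≥ R and
unit steps e,e': p₀ ≤ ‖A_{(x,e)}†A_{(y,e')}ψ‖² = ⟨n_{y↑}n_{y+e'↓}(1−n_{x↑})(1−n_{x+e↓})⟩_ψ — the
transplant mass (a four-point DENSITY correlation) is bounded below: no macroscopic segregation of
↑↓ neighbour pairs in any ground state. [difficulty: L] -/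
@[route_item "route-HubbardSuperconductivity-RelocationFloor"]
def PairSiteDensity : Prop :=
  open Literature.MathematicalPhysics.QuantumLattice Literature.Probability.LatticeModels in ∀ U ∈ Set.Icc (2 : ℝ) 5, ∀ δ ∈ Set.Icc (1 / 5 : ℝ) (3 / 10), ∃ p₀ : ℝ, 0 < p₀ ∧ ∃ R L₀ : ℕ, ∀ (L : ℕ) [NeZero L], L₀ ≤ L → Even L → ∀ ψ : Fock (Orb (FermionTorus 2 L)), star ψ ⬝ᵥ ψ = 1 → IsGroundStateInSector (hubbardTorus 2 L 1 U) (2 * ⌊(1 - δ) * (L : ℝ) ^ 2 / 2⌋₊) 0 ψ → ∀ x y : TorusSite 2 L, R ≤ torusDist x y → ∀ e ∈ unitSteps, ∀ e' ∈ unitSteps, let A : TorusSite 2 L → Site 2 → Matrix (Finset (Orb (FermionTorus 2 L))) (Finset (Orb (FermionTorus 2 L))) ℂ := fun z u => annihilation (orb (FermionTorus.ofTorusSite z) 0) * annihilation (orb (FermionTorus.ofTorusSite (z + Torus.proj L u)) 1); let φ : Fock (Orb (FermionTorus 2 L)) := ((A x e)ᴴ * A y e') *ᵥ ψ; p₀ ≤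 (star φ ⬝ᵥ φ).re

/-- item stmt-HubbardSuperconductivity-18071 · crux · rank 5 · open · by planner
why it might fail: weaker than PairSiteDensity (x-summed, Bloch states only), it fails only if some Bloch ground state in B macroscopically anti-correlates ↑↓ neighbour pairs with neighbour hole pairs at a far displacement — phase separation or commensurate charge order at the untested box edge U=5, δ=1/5.
sources: QinEtAl2020, XuEtAl2024, ArovasBergKivelsonRaghu2022, Sorella2023
[crux] BLOCH PAIR-SITE DENSITY (translation-summed transplant-mass floor): for every (U,δ) ∈
[2,5]×[1/5,3/10] there are p₀>0, R, L₀ such that for every even L ≥ L₀, every normalised Bloch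
(N_L,0)-sector ground state ψ, every r with torusDist r 0 ≥ R and unit steps e,e': p₀·L² ≤ Σ_x
‖A_{x,e}ᴴA_{x+r,e'}ψ‖² = Σ_x ⟨n_{x+r,↑}n_{x+r+e',↓}(1−n_{x,↑})(1−n_{x+e,↓})⟩_ψ. The Bloch-only,
x-summed form of the route's crux PairSiteDensity (which implies it by summing torusDist x (x+r) =
torusDist r 0 ≥ R over x); it normalises the modulus overlap of K4 by Cauchy–Schwarz (Σ_xΣ_τ|ψ||φ_x|
≤ L·Q^{1/2} ≤ Q/√p₀). [difficulty: L] -/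
@[route_item "route-HubbardSuperconductivity-RelocationFloor"]
def BlochPairSiteDensity : Prop :=
  open Literature.MathematicalPhysics.QuantumLattice Literature.Probability.LatticeModels in ∀ U ∈ Set.Icc (2 : ℝ) 5, ∀ δ ∈ Set.Icc (1 / 5 : ℝ) (3 / 10), ∃ p₀ : ℝ, 0 < p₀ ∧ ∃ R L₀ : ℕ, ∀ (L : ℕ) [NeZero L], L₀ ≤ L → Even L → ∀ ψ : Fock (Orb (FermionTorus 2 L)), star ψ ⬝ᵥ ψ = 1 → IsGroundStateInSector (hubbardTorus 2 L 1 U) (2 * ⌊(1 - δ) * (L : ℝ) ^ 2 / 2⌋₊) 0 ψ → (∀ v : TorusSite 2 L, ∃ c : ℂ, (fockTranslate v).val *ᵥ ψ = c • ψ) → ∀ r : TorusSite 2 L, R ≤ torusDist r 0 → ∀ e ∈ unitSteps, ∀ e' ∈ unitSteps, let A : TorusSite 2 L → Site 2 → Matrix (Finset (Orb (FermionTorus 2 L))) (Finset (Orb (FermionTorus 2 L))) ℂ := fun x u => annihilation (orb (FermionTorus.ofTorusSite x) 0) * annihilation (orb (FermionTorus.ofTorusSite (x + Torus.proj L u)) 1);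 let φ : TorusSite 2 L → Fock (Orb (FermionTorus 2 L)) := fun x => ((A x e)ᴴ * A (x + r) e') *ᵥ ψ; p₀ * (L : ℝ) ^ 2 ≤ ∑ x : TorusSite 2 L, (star (φ x) ⬝ᵥ φ x).re

/-- item stmt-HubbardSuperconductivity-15380 · support · rank 9 · closed · proved by Summit.HubbardSuperconductivity.HubbardSuperconductivity.Theorems.RelocationFloor.relocationFloorToUniformLRO_proof (prover) · by planner
sources: Scalapino1995, Yang1962, Feynman1953
[support] the floor (provable now): K4 at its point (U,δ) ∈ B, K3 and P3 there, give for each far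
displacement r and unit steps e,e': Σ_x g g'Re⟨ψ,A_{(x,e)}†A_{(x+r,e')}ψ⟩ ≥ 2εΣ_x Σ_τ|ψ||φ_x| ≥ 2ε
e^{−K} Σ_x Σ_{good τ}|φ_x|² ≥ ε e^{−K} p₀ L²; with pairField dWaveFormFactor L = √2 Σ_{z,e} g_d(e)
A_{(z,e)} (CAR reindexing of localPair: c_{x↓}c_{x+e↑} = −A_{(x+e,−e)}, g_d even) the order
functional is 2Σ_{r,e,e'}Σ_x g g'Re⟨…⟩ ≥ 32εe^{−K}p₀L²(L² − (2R+1)²) − 32(2R+1)²L² ≥ 16εe^{−K}p₀·L⁴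
eventually; 0<2≤U and [1/5,3/10] ⊂ (0,1/2) give the conclusion's side conditions. [difficulty:
provable-now] -/
@[route_item "route-HubbardSuperconductivity-RelocationFloor"]
def RelocationFloorToUniformLRO : Prop :=
  B1gSignCoherence → BoundedPairRelocationWork → PairSiteDensity → ∃ U : ℝ, 0 < U ∧ ∃ δ ∈ Set.Ioo (0 : ℝ) (1 / 2), ∃ a : ℝ, 0 < a ∧ ∃ L₀ : ℕ, ∀ (L : ℕ) [NeZero L], L₀ ≤ L → Even L → ∀ ψ : Literature.MathematicalPhysics.QuantumLattice.Fock (Literature.MathematicalPhysics.QuantumLattice.Orb (Literature.MathematicalPhysics.QuantumLattice.FermionTorus 2 L)), star ψ ⬝ᵥ ψ = 1 → Literature.MathematicalPhysics.QuantumLattice.IsGroundStateInSector (Literature.MathematicalPhysics.QuantumLattice.hubbardTorus 2 L 1 U) (2 * ⌊(1 - δ) * (L : ℝ) ^ 2 / 2⌋₊) 0 ψ → a * (L : ℝ) ^ 4 ≤ (Literature.MathematicalPhysics.QuantumLattice.expect ((Literature.MathematicalPhysics.QuantumLattice.pairField Literature.MathematicalPhysics.QuantumLattice.dWaveFormFactor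 L)ᴴ * Literature.MathematicalPhysics.QuantumLattice.pairField Literature.MathematicalPhysics.QuantumLattice.dWaveFormFactor L) ψ).re

-- `RelocationFloorToUniformLRO` holds: proved by `Summit.HubbardSuperconductivity.HubbardSuperconductivity.Theorems.RelocationFloor.relocationFloorToUniformLRO_proof` (its module imports this route file, so no `_holds` link can be stated here).

/-- item stmt-HubbardSuperconductivity-15381 · support · rank 9 · closed · proved by Summit.HubbardSuperconductivity.HubbardSuperconductivity.Theorems.liebTwin_uniformLROGivesSummitMatrix_proof @ 7109f46ab4d5 (prover) · by planner
sources: Scalapino1995, Yang1962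
[support] SHARED item stmt-HubbardSuperconductivity-10968 (route IntrinsicLargeN; PROVED:
Theorems/IntrinsicLargeNGlue uniformLROGivesSummitMatrix_proof; identical signature re-filed so the
gate attaches this route): an eventual uniform every-ground-state floor a·L⁴ ≤ Re⟨ψ,Δ_d†Δ_dψ⟩ at
(U,δ) gives the summit's matrix at (U,δ) (even-side liminf bookkeeping). [difficulty: provable-now] -/
@[route_item "route-HubbardSuperconductivity-RelocationFloor"]
def UniformLROGivesSummitMatrix : Prop :=
  ∀ U δ : ℝ, (∃ a : ℝ, 0 < a ∧ ∃ L₀ : ℕ, ∀ (L : ℕ) [NeZero L], L₀ ≤ L → Even L → ∀ ψ : Literature.MathematicalPhysics.QuantumLattice.Fock (Literature.MathematicalPhysics.QuantumLattice.Orb (Literature.MathematicalPhysics.QuantumLattice.FermionTorus 2 L)), star ψ ⬝ᵥ ψ = 1 → Literature.MathematicalPhysics.QuantumLattice.IsGroundStateInSector (Literature.MathematicalPhysics.QuantumLattice.hubbardTorus 2 L 1 U) (2 * ⌊(1 - δ) * (L : ℝ) ^ 2 / 2⌋₊) 0 ψ → a * (L : ℝ) ^ 4 ≤ (Literature.MathematicalPhysics.QuantumLattice.expect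 ((Literature.MathematicalPhysics.QuantumLattice.pairField Literature.MathematicalPhysics.QuantumLattice.dWaveFormFactor L)ᴴ * Literature.MathematicalPhysics.QuantumLattice.pairField Literature.MathematicalPhysics.QuantumLattice.dWaveFormFactor L) ψ).re) → ∀ (N : ℕ → ℕ) (ψ : ∀ L, Literature.MathematicalPhysics.QuantumLattice.Fock (Literature.MathematicalPhysics.QuantumLattice.Orb (Literature.MathematicalPhysics.QuantumLattice.FermionTorus 2 L))), (∀ L, Even L → N L = 2 * ⌊(1 - δ) * (L : ℝ) ^ 2 / 2⌋₊ ∧ star (ψ L) ⬝ᵥ ψ L = 1 ∧ Literature.MathematicalPhysics.QuantumLattice.IsGroundStateInSector (Literature.MathematicalPhysics.QuantumLattice.hubbardTorus 2 L 1 U) (N L) 0 (ψ L)) → Literature.Probability.LatticeModels.HasLongRangeOrder (fun k => Literature.Probability.LatticeModels.halfOpenBox 2 (2 * k)) (fun k => Literature.MathematicalPhysics.QuantumLattice.torusPullback (Literature.MathematicalPhysics.QuantumLattice.pairFieldCorr Literature.MathematicalPhysics.QuantumLattice.dWaveFormFactor ψ) (2 * k))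

/-- `UniformLROGivesSummitMatrix` holds: proved by `Summit.HubbardSuperconductivity.HubbardSuperconductivity.Theorems.liebTwin_uniformLROGivesSummitMatrix_proof` @ 7109f46ab4d5. -/
theorem UniformLROGivesSummitMatrix_holds : UniformLROGivesSummitMatrix := _root_.Summit.HubbardSuperconductivity.HubbardSuperconductivity.Theorems.liebTwin_uniformLROGivesSummitMatrix_proof

/-- item stmt-HubbardSuperconductivity-18072 · support · rank 9 · closed · proved by Summit.HubbardSuperconductivity.HubbardSuperconductivity.Theorems.RelocationFloor.b1gSignCoherenceOfSubs (prover) · by planner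
sources: Tasaki2020, Scalapino1995, Yang1962
[support] GLUE of the BC2-redirect decomposition of the deciding crux B1gSignCoherence (K4) into
DWaveChannelSelection (sign/channel) ∧ TransplantNondegeneracy (coherent fraction) ∧
BlochPairSiteDensity (mass floor); stands in for `route edit --split B1gSignCoherence` (bounced on
this strategist seat by the final-cycle rule — children.json attached as evidence on
stmt-HubbardSuperconductivity-15377 for whoever applies the split). PROVED: theorem
B1gSignCoherence_of_subs in
Summits/HubbardSuperconductivity/HubbardSuperconductivity/Cruxes/B1gSignCoherence/B1gSignCoherenceSplit.lean
@a53746bc64bf (farm lean rc0, 0 sorries, axioms propext/Classical.choice/Quot.sound; two variational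
Bloch reductions via exists_unit_common_eigenvector_isMinOn + Cauchy–Schwarz, ε' = ε√p₀) — that file
is verbatim the intended Theorems/RelocationFloorB1gSignCoherenceSplit.lean (Theorems is
prover-only): a prover lands it with --workitem <this item> adding `theorem b1gSignCoherenceOfSubs :
B1gSignCoherenceOfSubs := fun h1 h2 h3 => B1gSignCoherence_of_subs h1 h2 h3`. [deps:
DWaveChannelSelection, TransplantNondegeneracy, BlochPairSiteDensity] [difficulty: provable-now] -/
@[route_item "route-HubbardSuperconductivity-RelocationFloor"]
def B1gSignCoherenceOfSubs : Prop :=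
  DWaveChannelSelection → TransplantNondegeneracy → BlochPairSiteDensity → B1gSignCoherence

-- `B1gSignCoherenceOfSubs` holds: proved by `Summit.HubbardSuperconductivity.HubbardSuperconductivity.Theorems.RelocationFloor.b1gSignCoherenceOfSubs` (its module imports this route file, so no `_holds` link can be stated here).

/-- item stmt-HubbardSuperconductivity-15382 · assembly · rank 1 · closed · proved by Summit.HubbardSuperconductivity.HubbardSuperconductivity.Theorems.RelocationFloor.relocationFloor_assembly_proof (prover) · by planner
sources: Scalapino1995, Yang1962
[assembly] B1gSignCoherence → BoundedPairRelocationWork → PairSiteDensity →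
RelocationFloorToUniformLRO → UniformLROGivesSummitMatrix → HubbardSuperconductivity. -/
@[route_item "route-HubbardSuperconductivity-RelocationFloor"]
def Assembly : Prop :=
  B1gSignCoherence → BoundedPairRelocationWork → PairSiteDensity → RelocationFloorToUniformLRO → UniformLROGivesSummitMatrix → _root_.HubbardSuperconductivity

-- `Assembly` holds: proved by `Summit.HubbardSuperconductivity.HubbardSuperconductivity.Theorems.RelocationFloor.relocationFloor_assembly_proof` (its module imports this route file, so no `_holds` link can be stated here).

/-! D-0027 §2.1 — DECIDING THEOREM (planner-authored via `route open/edit --closes-file`; by planner-rrepair-HubbardSuperconductivity-Reloc-0e9f116d-0 2026-08-16T16:01:36Z):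
its hypotheses are this route's items and its conclusion the sub-problem Statement (glue_lint), and it elaborates with this file. -/

/-- Crux-only deciding theorem (cone repair, rev 3): both supports are proved inside. -/
@[closes "route-HubbardSuperconductivity-RelocationFloor"] theorem closes (h4 : B1gSignCoherence) (h3 : BoundedPairRelocationWork) (hp : PairSiteDensity) :
  _root_.HubbardSuperconductivity := open Literature.MathematicalPhysics.QuantumLattice Literature.Probability.LatticeModels Matrix Finset in by
 have hcard : ∀ (M : ℕ) [NeZero M], (Fintype.card (TorusSite 2 M) : ℝ) = (M:ℝ)^2 := fun M _ => by
  simp only [Fintype.card_pi, ZMod.card, prod_const, card_univ, Fintype.card_fin]; push_cast; ring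
 have hU : UniformLROGivesSummitMatrix := by
  rintro U δ ⟨c, hc, L₀, hL⟩ N ψ hy
  set Q := fun M => (∑ x ∈ halfOpenBox 2 M, ∑ y ∈ halfOpenBox 2 M, torusPullback (pairFieldCorr dWaveFormFactor ψ) M x y) / ((halfOpenBox 2 M).card : ℝ)^2 with hQ
  have T : ∀ M, M ≠ 0 → L₀ ≤ M → Even M → c ≤ Q M ∧ Q M ≤ (∑ e ∈ insert 0 unitSteps, ‖((dWaveFormFactor e / √2 : ℝ) : ℂ)‖ * 2)^2 := by
   intro M h0 hM hE; obtain ⟨m, rfl⟩ := Nat.exists_eq_add_one_of_ne_zero h0; obtain ⟨hN, hu, hg⟩ := hy (m + 1) hE; rw [hN] at hg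
   have hp : (0:ℝ) < ((m + 1 : ℕ) : ℝ)^(2*2) := by positivity
   simp only [hQ, sum_torusPullback_succ, le_div_iff₀ hp, div_le_iff₀ hp]
   refine ⟨by rw [sum_pairFieldCorr_succ]; exact hL (m + 1) hM hE _ hu hg, ?_⟩
   refine (sum_le_sum fun x _ => sum_le_sum fun y _ => pairFieldCorr_succ_le _ _ m hu x y).trans_eq ?_
   rw [sum_const, sum_const, card_univ, nsmul_eq_mul, nsmul_eq_mul, hcard]; ring
  exact lt_of_lt_of_le hc (le_liminf_of_le (isCoboundedUnder_ge_of_eventually_le _ (eventually_atTop.2 ⟨L₀ + 1, fun k hk => (T (2 * k) (by omega) (by omega) (even_two_mul k)).2⟩))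
   (eventually_atTop.2 ⟨L₀ + 1, fun k hk => (T (2 * k) (by omega) (by omega) (even_two_mul k)).1⟩))
 have hF : RelocationFloorToUniformLRO := by
  unfold RelocationFloorToUniformLRO B1gSignCoherence BoundedPairRelocationWork PairSiteDensity
  intro h4 h3 hp
  obtain ⟨U, hU, δ, hδ, ε, hε, R₄, L₄, hK4⟩ := h4
  obtain ⟨K, R₃, L₃, hK3⟩ := h3 U hU δ hδ
  obtain ⟨p₀, hp₀, R₅, L₅, hP3⟩ := hp U hU δ hδ
  set S := unitSteps with hS
  set g := dWaveFormFactor with hg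
  set R : ℕ := R₄ + R₃ + R₅ with hR
  set c₀ : ℝ := ε * Real.exp (-K) * p₀ with hc
  have hc₀ : 0 < c₀ := by positivity
  set s : ℝ := (S.card : ℝ) with hs
  set N : ℝ := (((2 * R + 1)^2 : ℕ) : ℝ) with hN
  obtain ⟨L₁, hL₁⟩ := exists_nat_ge (2 * N * (c₀ + s^2) / c₀)
  refine ⟨U, by linarith [hU.1], δ, ⟨by linarith [hδ.1], by linarith [hδ.2]⟩, c₀, hc₀, L₄ + L₃ + L₅ + L₁ + 1, ?_⟩
  intro L _ hL hE ψ hψ hgs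
  have hL₁L : (L₁:ℝ) ≤ L := by exact_mod_cast (show L₁ ≤ L by omega)
  have hL1 : (1:ℝ) ≤ L := by exact_mod_cast (show 1 ≤ L by omega)
  set A := fun (x : TorusSite 2 L) (u : Site 2) => annihilation (orb (FermionTorus.ofTorusSite x) 0) * annihilation (orb (FermionTorus.ofTorusSite (x + Torus.proj L u)) 1) with hA
  set B := fun (x : TorusSite 2 L) (u : Site 2) => annihilation (orb (FermionTorus.ofTorusSite x) 1) * annihilation (orb (FermionTorus.ofTorusSite (x + Torus.proj L u)) 0) with hBd
  set φ := fun (r x : TorusSite 2 L) (e e' : Site 2) => ((A x e)ᴴ * A (x + r) e') *ᵥ ψ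
  set F := fun (r : TorusSite 2 L) (e e' : Site 2) => g e' * (g e * ∑ x, (star ψ ⬝ᵥ φ r x e e').re) with hF
  have hx : ∀ r, R ≤ torusDist r 0 → ∀ x, ∀ e ∈ S, ∀ e' ∈ S, Real.exp (-K) * p₀ / 2 ≤ ∑ τ, ‖ψ τ‖ * ‖φ r x e e' τ‖ := by
   intro r hr x e he e' he'
   have hd : R ≤ torusDist x (x + r) := by
    unfold torusDist at hr ⊢; rwa [show x - (x + r) = -r by abel, torusNorm_neg, ← sub_zero r]
   set ν := φ r x e e'
   set W := univ.filter fun τ => Real.exp (-K) * ‖ν τ‖ ≤ ‖ψ τ‖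
   have k3 : (star ν ⬝ᵥ ν).re ≤ 2 * ∑ τ ∈ W, ‖ν τ‖^2 := hK3 L (by omega) hE ψ hψ hgs x (x + r) (le_trans (by omega) hd) e he e' he'
   have p3 : p₀ ≤ (star ν ⬝ᵥ ν).re := hP3 L (by omega) hE ψ hψ hgs x (x + r) (le_trans (by omega) hd) e he e' he'
   calc Real.exp (-K) * p₀ / 2 ≤ Real.exp (-K) * ∑ τ ∈ W, ‖ν τ‖^2 := by nlinarith [Real.exp_pos (-K)]
    _ ≤ ∑ τ ∈ W, ‖ψ τ‖ * ‖ν τ‖ := by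
      rw [mul_sum]; refine sum_le_sum fun τ hτ => ?_; rw [sq, ← mul_assoc]; exact mul_le_mul_of_nonneg_right (mem_filter.1 hτ).2 (norm_nonneg _)
    _ ≤ _ := sum_le_univ_sum_of_nonneg fun τ => mul_nonneg (norm_nonneg _) (norm_nonneg _)
  have hov : ∀ r x e e', |(star ψ ⬝ᵥ φ r x e e').re| ≤ 1 := by
   intro r x e e'; have h := norm_toLp_sq_eq_re ψ; rw [hψ, Complex.one_re] at h; have n0 := (sq_le_one_iff₀ (norm_nonneg _)).1 h.le
   have n1 : ∀ y u, ‖WithLp.toLp 2 (A y u *ᵥ ψ)‖ ≤ 1 := by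
    intro y u; simp only [hA, ← mulVec_mulVec]; exact ((norm_toLp_annihilation_mulVec_le _ _).trans (norm_toLp_annihilation_mulVec_le _ ψ)).trans n0
   have key : star ψ ⬝ᵥ φ r x e e' = star (A x e *ᵥ ψ) ⬝ᵥ (A (x + r) e' *ᵥ ψ) := PosSemidefTrace.expect_conjTranspose_mul _ _ ψ
   rw [key, star_dotProduct_eq_inner]
   exact (Complex.abs_re_le_norm _).trans ((norm_inner_le_norm _ _).trans (mul_le_one₀ (n1 _ _) (norm_nonneg _) (n1 _ _)))
  have hg1 : ∀ e, |g e| ≤ 1 := fun e => by rw [hg]; unfold dWaveFormFactor; split_ifs <;> norm_num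
  have E : (expect ((pairField g L)ᴴ * pairField g L) ψ).re = 2 * ∑ r, ∑ e' ∈ S, ∑ e ∈ S, F r e e' := by
   have E1 : pairField g L = (√2 : ℂ) • ∑ x, ∑ e ∈ S, (g e : ℂ) • A x e := by
    have ha : ∀ a b : Orb (FermionTorus 2 L), annihilation b * annihilation a = -(annihilation a * annihilation b) := fun a b => eq_neg_of_add_eq_zero_left (annihilation_anticommute_holds b a)
    have hB : ∀ e, ∑ x, B x e = -∑ x, A x (-e) := fun e => by
     rw [← sum_neg_distrib]; refine Fintype.sum_equiv (Equiv.addRight (Torus.proj L e)) _ _ fun x => ?_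
     simp only [hA, hBd, Equiv.coe_addRight, Torus.proj_neg, add_neg_cancel_right]; exact ha _ _
    have hm : ∀ e ∈ S, -e ∈ S := fun e he => by
     simp only [hS, unitSteps, Finset.mem_insert, Finset.mem_singleton] at he ⊢; rcases he with rfl | rfl | rfl | rfl <;> simp
    set w : Site 2 → ℂ := fun e => ((g e / √2 : ℝ) : ℂ) with hw
    have hT : ∑ e ∈ S, w e • ∑ x, A x (-e) = ∑ e ∈ S, w e • ∑ x, A x e := sum_nbij' (fun e => -e) (fun e => -e) hm hm (fun e _ => neg_neg e) (fun e _ => neg_neg e) fun e _ => by rw [show w (-e) = w e by simp only [hw, hg, dWaveFormFactor_neg]]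
    have hs : (√2 : ℂ) ≠ 0 := Complex.ofReal_ne_zero.2 (Real.sqrt_ne_zero'.2 two_pos)
    have h2 : (2 : ℂ) = (√2 : ℂ) * (√2 : ℂ) := by rw [← Complex.ofReal_mul, Real.mul_self_sqrt two_pos.le]; norm_num
    have h0 : (0 : Site 2) ∉ unitSteps := by simp only [unitSteps, Finset.mem_insert, Finset.mem_singleton]; decide
    calc pairField g L = ∑ e ∈ S, ∑ x, w e • (A x e - B x e) := by unfold pairField localPair; simp only [hA, hBd, hw, hg, hS]; rw [sum_comm, sum_insert h0, dWaveFormFactor_zero, zero_div, Complex.ofReal_zero]; simp only [zero_smul, sum_const_zero, zero_add]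
     _ = ∑ e ∈ S, w e • ∑ x, A x e + ∑ e ∈ S, w e • ∑ x, A x (-e) := by
       rw [← sum_add_distrib]; exact sum_congr rfl fun e _ => by rw [← smul_sum, sum_sub_distrib, hB, sub_neg_eq_add, smul_add]
     _ = ∑ e ∈ S, ((√2 : ℂ) * (g e : ℂ)) • ∑ x, A x e := by
       rw [hT, ← sum_add_distrib]
       exact sum_congr rfl fun e _ => by rw [← add_smul, ← two_mul]; simp only [hw, Complex.ofReal_div]; rw [h2, mul_assoc, ← mul_div_assoc, mul_div_cancel_left₀ _ hs]
     _ = (√2 : ℂ) • ∑ x, ∑ e ∈ S, (g e : ℂ) • A x e := by simp only [smul_sum, smul_smul]; exact sum_comm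
   rw [E1, conjTranspose_smul, Matrix.smul_mul, Matrix.mul_smul, smul_smul, expect_smul, Complex.star_def, Complex.conj_ofReal, ← Complex.ofReal_mul, Complex.re_ofReal_mul, Real.mul_self_sqrt two_pos.le]
   congr 1; rw [conjTranspose_sum, sum_mul, expect_sum, Complex.re_sum]; simp only [Matrix.mul_sum, expect_sum, Complex.re_sum]
   have st : ∀ f : TorusSite 2 L → TorusSite 2 L → ℝ, ∑ x, ∑ y, f x y = ∑ r, ∑ x, f x (x + r) := fun f => (sum_congr rfl fun x _ => (Fintype.sum_equiv (Equiv.addLeft x) _ _ fun r => rfl).symm).trans sum_comm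
   rw [st]; refine sum_congr rfl fun r _ => ?_
   simp only [hF, conjTranspose_sum, conjTranspose_smul, Complex.star_def, Complex.conj_ofReal, Matrix.sum_mul, Matrix.smul_mul, Matrix.mul_smul, expect_sum, expect_smul, Complex.re_sum, Complex.re_ofReal_mul, mul_sum]
   rw [sum_comm]; exact sum_congr rfl fun e' _ => sum_comm
  rw [E]
  have far : ∀ r, R ≤ torusDist r 0 → c₀ * (L:ℝ)^2 ≤ ∑ e' ∈ S, ∑ e ∈ S, F r e e' := by
   intro r hr
   have hi : ∀ e ∈ S, ∀ e' ∈ S, c₀ * (L:ℝ)^2 ≤ F r e e' := by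
    intro e he e' he'
    refine le_trans ?_ ((hK4 L (by omega) hE ψ hψ hgs r (le_trans (by omega) hr) e he e' he').trans_eq (by simp only [hF]; ring))
    calc c₀ * (L:ℝ)^2 = 2 * ε * ∑ x : TorusSite 2 L, Real.exp (-K) * p₀ / 2 := by rw [sum_const, card_univ, nsmul_eq_mul, hcard L, hc]; ring
     _ ≤ _ := mul_le_mul_of_nonneg_left (sum_le_sum fun x _ => hx r hr x e he e' he') (by positivity)
   have h0 : 0 ≤ c₀ * (L:ℝ)^2 := by positivity
   have hm : (Pi.single 0 1 : Site 2) ∈ S := mem_insert_self _ _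
   exact ((hi _ hm _ hm).trans (single_le_sum (fun e he => h0.trans (hi e he _ hm)) hm)).trans (single_le_sum (fun e' he' => sum_nonneg fun e he => h0.trans (hi e he e' he')) hm)
  have near : ∀ r, -(s^2 * (L:ℝ)^2) ≤ ∑ e' ∈ S, ∑ e ∈ S, F r e e' := by
   intro r
   have ht : ∀ e e', -(L:ℝ)^2 ≤ F r e e' := fun e e' => by
    have hsum : |∑ x, (star ψ ⬝ᵥ φ r x e e').re| ≤ (L:ℝ)^2 := (abs_sum_le_sum_abs _ _).trans (le_of_le_of_eq (sum_le_sum fun x _ => hov r x e e') (by rw [sum_const, card_univ, nsmul_eq_mul, mul_one, hcard L]))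
    refine neg_le_of_abs_le ?_; simp only [hF, abs_mul]
    exact (mul_le_mul (hg1 e') (mul_le_mul (hg1 e) hsum (abs_nonneg _) zero_le_one) (mul_nonneg (abs_nonneg _) (abs_nonneg _)) zero_le_one).trans_eq (by ring)
   calc -(s^2 * (L:ℝ)^2) = ∑ _e ∈ S, ∑ _e' ∈ S, -(L:ℝ)^2 := by rw [sum_const, sum_const, nsmul_eq_mul, nsmul_eq_mul]; ring
    _ ≤ _ := sum_le_sum fun e' _ => sum_le_sum fun e _ => ht e e'
  set P := fun r : TorusSite 2 L => R ≤ torusDist r 0 with hP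
  rw [← sum_filter_add_sum_filter_not univ P]
  set nf : ℝ := ((univ.filter P).card : ℝ) with hnf
  set nn : ℝ := ((univ.filter fun r => ¬P r).card : ℝ) with hnn
  have hfar := card_nsmul_le_sum (univ.filter P) (fun r => ∑ e' ∈ S, ∑ e ∈ S, F r e e') _ fun r hr => far r (mem_filter.1 hr).2
  have hnear := card_nsmul_le_sum (univ.filter fun r => ¬P r) (fun r => ∑ e' ∈ S, ∑ e ∈ S, F r e e') _ fun r _ => near r
  rw [nsmul_eq_mul, ← hnf] at hfar; rw [nsmul_eq_mul, ← hnn] at hnear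
  have hcnt : nf + nn = (L:ℝ)^2 := by rw [hnf, hnn, ← Nat.cast_add, card_filter_add_card_filter_not, card_univ, hcard L]
  have hnN : nn ≤ N := by
   set Bz : Finset (ZMod L) := univ.filter fun z : ZMod L => min z.val (L - z.val) ≤ R with hBz
   have hsub : ∀ u ∈ (univ.filter fun r => ¬P r), u - 0 ∈ Fintype.piFinset fun _ : Fin 2 => Bz := by
    intro u hu; simp only [hP, mem_filter, Finset.mem_univ, true_and, not_le] at hu; unfold torusDist at hu; simp only [torusNorm] at hu
    rw [Fintype.mem_piFinset]; intro i; simp only [hBz, mem_filter, Finset.mem_univ, true_and]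
    exact (Finset.le_sup (f := fun i => min ((u - 0) i).val (L - ((u - 0) i).val)) (Finset.mem_univ i)).trans hu.le
   rw [hnn, hN]
   exact_mod_cast (card_le_card_of_injOn (fun u => u - 0) hsub fun u _ v _ h => by simpa using h).trans ((Fintype.card_piFinset_const _ _).trans_le (Nat.pow_le_pow_left (card_filter_cyclicAbs_le_le R) 2))
  have key : 2 * N * (c₀ + s^2) ≤ c₀ * (L:ℝ)^2 :=
   calc 2 * N * (c₀ + s^2) ≤ (L₁:ℝ) * c₀ := (div_le_iff₀ hc₀).1 hL₁
    _ ≤ (L:ℝ)^2 * c₀ := mul_le_mul_of_nonneg_right (by nlinarith) hc₀.le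
    _ = _ := mul_comm _ _
  have i5 : nf * (c₀ * (L:ℝ)^2) = c₀ * (L:ℝ)^2 * (L:ℝ)^2 - nn * (c₀ * (L:ℝ)^2) := by
   rw [← hcnt]; ring
  linarith [hfar, hnear, i5, mul_le_mul_of_nonneg_right hnN (by positivity : (0:ℝ) ≤ (c₀ + s^2) * (L:ℝ)^2), mul_le_mul_of_nonneg_right key (by positivity : (0:ℝ) ≤ (L:ℝ)^2)]
 obtain ⟨U, hU0, δ, hδ, a, ha, L₀, h⟩ := hF h4 h3 hp
 exact ⟨U, hU0, δ, hδ, hU U δ ⟨a, ha, L₀, h⟩⟩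

end Summit.HubbardSuperconductivity.HubbardSuperconductivity.Theses.RelocationFloor
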